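import Summits.QuantumFields.YangMills.Theorems.BalabanUVNodesN19UniformMomentSummabilityThresholdSharp
import Mathlib.Analysis.SpecialFunctions.Trigonometric.Chebyshev.RootsExtrema
import Mathlib.MeasureTheory.Integral.DominatedConvergence

/-!
# YM-DAG node N19 (= NE7 proper) — FIXED OBSERVABLES UNDER THE UNIFORM-MOMENT CURRENCY, VI: THE CHEBYSHEV-COEFFICIENT ROAD (EVERY sequence):
# an observable with `Σ_j (j+1)|a_j| < ∞` in a Chebyshev expansion converges ABSOLUTELY under uniform moment matching at geometric closeness

Cell `pub-ymgap`, HUMAN RULING D-0062 (Track A) ∕ D-0149 (work-bound push), R141 (C) wider-strategy seat `pub-ymgap-dag-n19-e` (strategy s3 =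
ALTERNATIVE CURRENCY), generation g24, module 6 (lineage module 90; parts I–V = modules 85–89 treat ARC CHAINS and general Lipschitz tests; this part
treats EVERY sequence and SMOOTHER tests).  Route `Summits/QuantumFields/YangMills/Theses/BalabanUVNodes.lean` rev 25, cluster item K3⁷
«SpineGivenEndpointR13SepCoPH» (stmt-QuantumFields-20544); filed `--supports` that item `--as helper` (it proves no registered stub).  COUNT-NEUTRAL:
[folklore] real analysis over Mathlib (Chebyshev `T_add_two`, `abs_eval_T_real_le_one`; dominated convergence for series `hasSum_integral_of_dominated_convergence`;
`norm_tsum_le_tsum_norm`, `Summable.tsum_finsetSum`, `hasSum_geometric_of_lt_one`); imports module 79 only for the lineage order; no scheme object, no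
Theses import; NOT a discharge claim.

THE QUESTION (HOME `CURRENCY-MAP.md` v2∕v3, open item (w)): under the UNIFORM-MOMENT currency at geometric closeness `Cθ^K`, do the increments of a
FIXED observable converge absolutely along EVERY sequence of laws?  For arc chains modules 87–89 say YES for every Lipschitz test; for a GENERAL
sequence this file gives the smooth half.  §1 ★ `abs_integral_pow_mul_T_sub_le`: if all monomial moments of two probability laws on `[−1,1]` are
`r`-close then `|∫x^i T_j dμ − ∫x^i T_j dν| ≤ 3^j r` for all `i` (two-step induction on the recurrence `T_{j+2} = 2xT_{j+1} − T_j`, all `i` at once — no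
coefficient bookkeeping); with `|T_j| ≤ 1`: `|∫T_j dμ − ∫T_j dν| ≤ min(2, 3^j r)`.  §2 ★ `abs_integral_sub_le_tsum_of_chebyshev`: for an observable
`g = Σ_j a_j T_j` on `[−1,1]` with `Σ|a_j| < ∞`, ONE step costs `≤ Σ_j |a_j| min(2, 3^j r)` (dominated term-by-term integration).  §3 ★★
`sum_abs_increments_le_of_chebyshev` ∕ `summable_abs_increments_of_chebyshev`: along EVERY sequence `Λ_K` with all moments `Cθ^K`-close (`0 < θ < 1`) and
every `g` with `Σ|a_j| < ∞`, `Σ j|a_j| < ∞`: `Σ_K |∫g dΛ_{K+1} − ∫g dΛ_K| ≤ Σ_j |a_j|(2((j log 3 + log⁺C)∕log θ⁻¹ + 1) + 1∕(1−θ)) < ∞` — the `j`-th Chebyshev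
mode is seen at full size for `≍ j log 3∕log θ⁻¹` steps and geometrically afterwards (`sum_min_two_geometric_le`).
READING.  `Σ j|a_j| < ∞` holds for `C^{2+ε}`-type observables and fails at the border `|x|` (`a_j ≍ 1∕j²`); whether EVERY fixed Lipschitz observable
converges absolutely along EVERY uniform-geometric sequence stays OPEN (HOME `CURRENCY-MAP.md` v3: a Banach–Steinhaus heuristic suggests NO, with
`√log N` growth of the worst partial sums; not typed).  The constant `3^j` is crude (`(1+√2)^j` is the truth); only `log 3` enters.

HONEST FRAMING (binding).  Elementary and [folklore]; toy laws, no scheme object; NO consumer in the DAG today (a structural statement about the seat's own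
currencies); nothing of Bałaban's instantiated; NE7 NOT PRINTED, NOT proved; N19 NOT discharged; count-neutral.  One finite `T⁴` programme at fixed `ε`;
nothing continuum ∕ `ℝ⁴` ∕ OS ∕ mass-gap ∕ Clay.  0 `def` ∕ 0 `sorry`.
-/

noncomputable section

open Real Finset MeasureTheory ProbabilityTheory Polynomial Polynomial.Chebyshev

namespace Summit.QuantumFields.YangMills.Theorems.BalabanUVNodesN19UniformMomentsChebyshevRoad

variable {μ ν : Measure ℝ}

/-! ## §1 Uniform moment closeness controls the Chebyshev moments: `|∫T_j dμ − ∫T_j dν| ≤ 3^j r` [folklore] -/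

/-- A law carried by `[−1,1]` sees `|x| ≤ 1` almost everywhere. [bookkeeping] -/
theorem ae_abs_le_one (hμ : μ (Set.Icc (-1 : ℝ) 1)ᶜ = 0) : ∀ᵐ x ∂μ, |x| ≤ 1 := by
  have h : ∀ᵐ x ∂μ, x ∈ Set.Icc (-1 : ℝ) 1 := by
    rw [ae_iff]
    simpa only [Set.mem_Icc, Set.compl_def] using hμ
  exact h.mono fun x hx => abs_le.2 ⟨hx.1, hx.2⟩

/-- `x ↦ x^i T_j(x)` is integrable against a probability law on `[−1,1]` (bounded by `1` a.e.). [bookkeeping] -/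
theorem integrable_pow_mul_T [IsProbabilityMeasure μ] (hμ : μ (Set.Icc (-1 : ℝ) 1)ᶜ = 0) (i : ℕ) (j : ℤ) :
    Integrable (fun x : ℝ => x ^ i * (T ℝ j).eval x) μ := by
  refine Integrable.of_bound (C := 1) ((continuous_pow i).mul (Polynomial.continuous _)).aestronglyMeasurable
    ((ae_abs_le_one hμ).mono fun x hx => ?_)
  rw [Real.norm_eq_abs, abs_mul, abs_pow]
  exact mul_le_one₀ (pow_le_one₀ (abs_nonneg _) hx) (abs_nonneg _) (abs_eval_T_real_le_one j hx)

/-- ★ **THE CHEBYSHEV MOMENTS ARE `3^j r`-CLOSE** when all monomial moments are `r`-close: by the recurrence `T_{j+2} = 2xT_{j+1} − T_j`, for every `i`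
`|∫x^i T_j dμ − ∫x^i T_j dν| ≤ 3^j r` (two-step induction, all `i` at once; no coefficient bookkeeping). [folklore] -/
theorem abs_integral_pow_mul_T_sub_le [IsProbabilityMeasure μ] [IsProbabilityMeasure ν]
    (hμ : μ (Set.Icc (-1 : ℝ) 1)ᶜ = 0) (hν : ν (Set.Icc (-1 : ℝ) 1)ᶜ = 0) {r : ℝ}
    (hmom : ∀ i : ℕ, |∫ x, x ^ i ∂μ - ∫ x, x ^ i ∂ν| ≤ r) (j i : ℕ) :
    |∫ x, x ^ i * (T ℝ j).eval x ∂μ - ∫ x, x ^ i * (T ℝ j).eval x ∂ν| ≤ 3 ^ j * r := by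
  have hr : 0 ≤ r := (abs_nonneg _).trans (hmom 0)
  -- two-step induction on `j`, for all `i` simultaneously
  suffices h : ∀ j : ℕ, (∀ i : ℕ, |∫ x, x ^ i * (T ℝ j).eval x ∂μ - ∫ x, x ^ i * (T ℝ j).eval x ∂ν| ≤ 3 ^ j * r) ∧
      (∀ i : ℕ, |∫ x, x ^ i * (T ℝ ((j : ℤ) + 1)).eval x ∂μ - ∫ x, x ^ i * (T ℝ ((j : ℤ) + 1)).eval x ∂ν| ≤ 3 ^ (j + 1) * r) from
    (h j).1 i
  intro j
  induction j with
  | zero =>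
    refine ⟨fun i => ?_, fun i => ?_⟩
    · simpa [T_zero] using hmom i
    · have e : ∀ (κ : Measure ℝ), ∫ x, x ^ i * (T ℝ ((0 : ℕ) + 1 : ℤ)).eval x ∂κ = ∫ x, x ^ (i + 1) ∂κ := fun κ => by
        refine integral_congr_ae (Filter.Eventually.of_forall fun x => ?_)
        simp [T_one, pow_succ]
      rw [e μ, e ν]
      exact (hmom (i + 1)).trans (by rw [zero_add, pow_one]; linarith)
  | succ j ih =>
    obtain ⟨ih0, ih1⟩ := ih
    refine ⟨fun i => by exact_mod_cast ih1 i, fun i => ?_⟩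
    -- `x^i T_{j+2} = 2 x^{i+1} T_{j+1} − x^i T_j`
    have e : ∀ x : ℝ, x ^ i * (T ℝ (((j + 1 : ℕ) : ℤ) + 1)).eval x =
        2 * (x ^ (i + 1) * (T ℝ ((j : ℤ) + 1)).eval x) - x ^ i * (T ℝ (j : ℤ)).eval x := by
      intro x
      have h := T_add_two ℝ (j : ℤ)
      rw [show ((j + 1 : ℕ) : ℤ) + 1 = (j : ℤ) + 2 by push_cast; ring, h]
      simp only [eval_sub, eval_mul, eval_ofNat, eval_X]
      ring
    have hint : ∀ (κ : Measure ℝ) [IsProbabilityMeasure κ], κ (Set.Icc (-1 : ℝ) 1)ᶜ = 0 →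
        ∫ x, x ^ i * (T ℝ (((j + 1 : ℕ) : ℤ) + 1)).eval x ∂κ =
          2 * ∫ x, x ^ (i + 1) * (T ℝ ((j : ℤ) + 1)).eval x ∂κ - ∫ x, x ^ i * (T ℝ (j : ℤ)).eval x ∂κ := by
      intro κ _ hκ
      simp_rw [e]
      rw [integral_sub ((integrable_pow_mul_T hκ (i + 1) _).const_mul 2) (integrable_pow_mul_T hκ i _), integral_const_mul]
    rw [hint μ hμ, hint ν hν]
    have h1 := ih1 (i + 1)
    have h0 := ih0 i
    calc |2 * ∫ x, x ^ (i + 1) * (T ℝ ((j : ℤ) + 1)).eval x ∂μ - ∫ x, x ^ i * (T ℝ (j : ℤ)).eval x ∂μ -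
          (2 * ∫ x, x ^ (i + 1) * (T ℝ ((j : ℤ) + 1)).eval x ∂ν - ∫ x, x ^ i * (T ℝ (j : ℤ)).eval x ∂ν)|
        = |2 * (∫ x, x ^ (i + 1) * (T ℝ ((j : ℤ) + 1)).eval x ∂μ - ∫ x, x ^ (i + 1) * (T ℝ ((j : ℤ) + 1)).eval x ∂ν) -
            (∫ x, x ^ i * (T ℝ (j : ℤ)).eval x ∂μ - ∫ x, x ^ i * (T ℝ (j : ℤ)).eval x ∂ν)| := by ring_nf
      _ ≤ 2 * (3 ^ (j + 1) * r) + 3 ^ j * r := by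
          refine (abs_sub _ _).trans (add_le_add ?_ h0)
          rw [abs_mul, abs_two]
          exact mul_le_mul_of_nonneg_left h1 (by norm_num)
      _ ≤ 3 ^ (j + 1 + 1) * r := by
          have : (0 : ℝ) ≤ 3 ^ j * r := by positivity
          nlinarith [pow_succ (3 : ℝ) j, pow_succ (3 : ℝ) (j + 1)]

/-- The Chebyshev moments themselves: `|∫T_j dμ − ∫T_j dν| ≤ min(2, 3^j r)` (`|T_j| ≤ 1` on `[−1,1]` gives the `2`). [folklore] -/
theorem abs_integral_T_sub_le_min [IsProbabilityMeasure μ] [IsProbabilityMeasure ν]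
    (hμ : μ (Set.Icc (-1 : ℝ) 1)ᶜ = 0) (hν : ν (Set.Icc (-1 : ℝ) 1)ᶜ = 0) {r : ℝ}
    (hmom : ∀ i : ℕ, |∫ x, x ^ i ∂μ - ∫ x, x ^ i ∂ν| ≤ r) (j : ℕ) :
    |∫ x, (T ℝ j).eval x ∂μ - ∫ x, (T ℝ j).eval x ∂ν| ≤ min 2 (3 ^ j * r) := by
  refine le_min ?_ ?_
  · have hb : ∀ (κ : Measure ℝ) [IsProbabilityMeasure κ], κ (Set.Icc (-1 : ℝ) 1)ᶜ = 0 → |∫ x, (T ℝ j).eval x ∂κ| ≤ 1 := by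
      intro κ _ hκ
      have h := norm_integral_le_of_norm_le_const (μ := κ) (f := fun x : ℝ => (T ℝ j).eval x) (C := 1)
        ((ae_abs_le_one hκ).mono fun x hx => by rw [Real.norm_eq_abs]; exact abs_eval_T_real_le_one _ hx)
      simpa using h
    calc |∫ x, (T ℝ j).eval x ∂μ - ∫ x, (T ℝ j).eval x ∂ν| ≤ |∫ x, (T ℝ j).eval x ∂μ| + |∫ x, (T ℝ j).eval x ∂ν| := abs_sub _ _
      _ ≤ 1 + 1 := add_le_add (hb μ hμ) (hb ν hν)
      _ = 2 := by norm_num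
  · simpa using abs_integral_pow_mul_T_sub_le hμ hν hmom j 0

/-! ## §2 One step: a Chebyshev-summable observable moves by `Σ_j |a_j| min(2, 3^j r)` [folklore] -/

/-- ★ **ONE STEP OF THE CHEBYSHEV ROAD.**  If `g = Σ_j a_j T_j` on `[−1,1]` with `Σ|a_j| < ∞`, then for probability laws `μ, ν` on `[−1,1]` with all
monomial moments `r`-close: `|∫g dμ − ∫g dν| ≤ Σ_j |a_j|·min(2, 3^j r)` (dominated term-by-term integration, §1). [folklore] -/
theorem abs_integral_sub_le_tsum_of_chebyshev [IsProbabilityMeasure μ] [IsProbabilityMeasure ν]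
    (hμ : μ (Set.Icc (-1 : ℝ) 1)ᶜ = 0) (hν : ν (Set.Icc (-1 : ℝ) 1)ᶜ = 0) {r : ℝ}
    (hmom : ∀ i : ℕ, |∫ x, x ^ i ∂μ - ∫ x, x ^ i ∂ν| ≤ r)
    {g : ℝ → ℝ} {a : ℕ → ℝ} (ha : Summable fun j => |a j|)
    (hg : ∀ x ∈ Set.Icc (-1 : ℝ) 1, HasSum (fun j => a j * (T ℝ j).eval x) (g x)) :
    |∫ x, g x ∂μ - ∫ x, g x ∂ν| ≤ ∑' j : ℕ, |a j| * min 2 (3 ^ j * r) := by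
  have hr : 0 ≤ r := (abs_nonneg _).trans (hmom 0)
  -- term-by-term integration against each law
  have hsum : ∀ (κ : Measure ℝ) [IsProbabilityMeasure κ], κ (Set.Icc (-1 : ℝ) 1)ᶜ = 0 →
      HasSum (fun j => a j * ∫ x, (T ℝ j).eval x ∂κ) (∫ x, g x ∂κ) := by
    intro κ _ hκ
    have hae : ∀ᵐ x ∂κ, x ∈ Set.Icc (-1 : ℝ) 1 := by
      rw [ae_iff]; simpa only [Set.mem_Icc, Set.compl_def] using hκ
    have h := hasSum_integral_of_dominated_convergence (μ := κ) (F := fun j x => a j * (T ℝ j).eval x) (f := g)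
      (fun j _ => |a j|) (fun j => (continuous_const.mul (Polynomial.continuous _)).aestronglyMeasurable) (fun j => ?_) ?_ ?_ ?_
    · simpa only [integral_const_mul] using h
    · exact hae.mono fun x hx => by
        rw [Real.norm_eq_abs, abs_mul]
        exact mul_le_of_le_one_right (abs_nonneg _) (abs_eval_T_real_le_one _ (abs_le.2 ⟨hx.1, hx.2⟩))
    · exact Filter.Eventually.of_forall fun x => ha
    · exact integrable_const _
    · exact hae.mono fun x hx => hg x hx
  have hμs := hsum μ hμ
  have hνs := hsum ν hν
  have hdiff : HasSum (fun j => a j * (∫ x, (T ℝ j).eval x ∂μ - ∫ x, (T ℝ j).eval x ∂ν)) (∫ x, g x ∂μ - ∫ x, g x ∂ν) := by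
    have h := hμs.sub hνs
    have e : (fun j => a j * ∫ x, (T ℝ j).eval x ∂μ - a j * ∫ x, (T ℝ j).eval x ∂ν) =
        fun j => a j * (∫ x, (T ℝ j).eval x ∂μ - ∫ x, (T ℝ j).eval x ∂ν) := by
      funext j; ring
    rw [e] at h
    exact h
  have hbd : Summable fun j : ℕ => |a j| * min 2 (3 ^ j * r) :=
    Summable.of_nonneg_of_le (fun j => by positivity) (fun j => mul_le_mul_of_nonneg_left (min_le_left _ _) (abs_nonneg _))
      (ha.mul_right 2)
  rw [← hdiff.tsum_eq]
  have hn : Summable fun j : ℕ => ‖a j * (∫ x, (T ℝ j).eval x ∂μ - ∫ x, (T ℝ j).eval x ∂ν)‖ :=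
    Summable.of_nonneg_of_le (fun j => norm_nonneg _) (fun j => by
      rw [Real.norm_eq_abs, abs_mul]
      exact mul_le_mul_of_nonneg_left (abs_integral_T_sub_le_min hμ hν hmom j) (abs_nonneg _)) hbd
  refine (norm_tsum_le_tsum_norm hn).trans (Summable.tsum_le_tsum (fun j => ?_) hn hbd)
  rw [Real.norm_eq_abs, abs_mul]
  exact mul_le_mul_of_nonneg_left (abs_integral_T_sub_le_min hμ hν hmom j) (abs_nonneg _)

/-! ## §3 Along the tower at geometric closeness [folklore] -/

/-- The step count of the Chebyshev road: `Σ_{K<N} min(2, 3^j·C·θ^K) ≤ 2(⌈x_j⌉ + 1)·… ≤ 2x_j + 2 + 1∕(1−θ)` with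
`x_j = (j·log 3 + log⁺ C)∕log θ⁻¹` — `≍ j` steps see the `j`-th Chebyshev moment at full size, then a geometric tail. [folklore] -/
theorem sum_min_two_geometric_le {C θ : ℝ} (hC : 0 < C) (hθ0 : 0 < θ) (hθ1 : θ < 1) (j N : ℕ) :
    ∑ K ∈ Finset.range N, min 2 (3 ^ j * (C * θ ^ K)) ≤
      2 * ((j * Real.log 3 + Real.posLog C) / Real.log θ⁻¹ + 1) + 1 / (1 - θ) := by
  set lam : ℝ := Real.log θ⁻¹ with hlam
  have hlam_pos : 0 < lam := Real.log_pos ((one_lt_inv₀ hθ0).2 hθ1)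
  set x : ℝ := (j * Real.log 3 + Real.posLog C) / lam with hx
  have hx0 : 0 ≤ x := div_nonneg (add_nonneg (mul_nonneg (Nat.cast_nonneg j) (Real.log_nonneg (by norm_num))) Real.posLog_nonneg) hlam_pos.le
  set m : ℕ := ⌈x⌉₊ with hm
  have hm_le : (m : ℝ) ≤ x + 1 := (Nat.ceil_lt_add_one hx0).le
  have hxm : x ≤ m := Nat.le_ceil x
  -- beyond `m` steps the term is `≤ θ^{K−m}`: `3^j C θ^m ≤ 1`
  have hsmall : 3 ^ j * (C * θ ^ m) ≤ 1 := by
    have h1 : Real.log (3 ^ j * (C * θ ^ m)) ≤ 0 := by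
      rw [Real.log_mul (by positivity) (by positivity), Real.log_mul hC.ne' (by positivity), Real.log_pow, Real.log_pow]
      have hlogθ : Real.log θ = -lam := by rw [hlam, Real.log_inv, neg_neg]
      rw [hlogθ]
      have hC' : Real.log C ≤ Real.posLog C := by rw [Real.posLog_apply]; exact le_max_right _ _
      have hmx : (j * Real.log 3 + Real.posLog C) ≤ m * lam := by
        rw [hx, div_le_iff₀ hlam_pos] at hxm; linarith
      nlinarith
    by_contra hcon
    exact absurd h1 (not_le.2 (Real.log_pos (lt_of_not_ge hcon)))
  have hterm : ∀ K : ℕ, min 2 (3 ^ j * (C * θ ^ K)) ≤ if K < m then 2 else θ ^ (K - m) := by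
    intro K
    split_ifs with hK
    · exact min_le_left _ _
    · have hK : m ≤ K := not_lt.1 hK
      refine (min_le_right _ _).trans ?_
      calc 3 ^ j * (C * θ ^ K) = 3 ^ j * (C * θ ^ m) * θ ^ (K - m) := by
            rw [← Nat.add_sub_cancel' hK, pow_add, Nat.add_sub_cancel' hK]; ring
        _ ≤ 1 * θ ^ (K - m) := mul_le_mul_of_nonneg_right hsmall (by positivity)
        _ = θ ^ (K - m) := one_mul _
  have hgeom : HasSum (fun t : ℕ => θ ^ t) (1 / (1 - θ)) := by
    rw [one_div]; exact hasSum_geometric_of_lt_one hθ0.le hθ1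
  calc ∑ K ∈ Finset.range N, min 2 (3 ^ j * (C * θ ^ K))
      ≤ ∑ K ∈ Finset.range N, (if K < m then (2 : ℝ) else θ ^ (K - m)) := Finset.sum_le_sum fun K _ => hterm K
    _ = ∑ K ∈ (Finset.range N).filter (fun K => K < m), (2 : ℝ) +
          ∑ K ∈ (Finset.range N).filter (fun K => ¬ K < m), θ ^ (K - m) := Finset.sum_ite _ _
    _ ≤ 2 * m + 1 / (1 - θ) := by
        refine add_le_add ?_ ?_
        · rw [Finset.sum_const, nsmul_eq_mul, mul_comm]
          refine mul_le_mul_of_nonneg_left ?_ (by norm_num)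
          have hsub : (Finset.range N).filter (fun K => K < m) ⊆ Finset.range m := fun K hK =>
            Finset.mem_range.2 (Finset.mem_filter.1 hK).2
          exact_mod_cast (Finset.card_le_card hsub).trans (Finset.card_range m).le
        · -- reindex `K ↦ K − m` into the geometric series
          have hinj : Set.InjOn (fun K => K - m) ((Finset.range N).filter (fun K => ¬ K < m)) := by
            intro K₁ h₁ K₂ h₂ h
            have h₁' := not_lt.1 (Finset.mem_filter.1 (Finset.mem_coe.1 h₁)).2
            have h₂' := not_lt.1 (Finset.mem_filter.1 (Finset.mem_coe.1 h₂)).2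
            simp only at h
            omega
          rw [← Finset.sum_image (f := fun t : ℕ => θ ^ t) hinj]
          exact sum_le_hasSum _ (fun t _ => by positivity) hgeom
    _ ≤ 2 * (x + 1) + 1 / (1 - θ) := by linarith

/-- ★★ **THE CHEBYSHEV-COEFFICIENT ROAD (EVERY uniform-moment sequence).**  Let `Λ_K` be probability laws on `[−1,1]` with ALL monomial moments
`Cθ^K`-close step to step (`C > 0`, `0 < θ < 1`), and let the observable `g = Σ_j a_j T_j` on `[−1,1]` have `Σ_j |a_j| < ∞` and `Σ_j j|a_j| < ∞`.  Then for
every `N`: `Σ_{K<N} |∫g dΛ_{K+1} − ∫g dΛ_K| ≤ Σ_j |a_j|·(2((j log 3 + log⁺C)∕log θ⁻¹ + 1) + 1∕(1−θ))` — ABSOLUTE convergence of the expectations of `g`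
along EVERY such sequence (contrast: for general Lipschitz `g` only arc chains are known to behave, modules 87–89; `|x|` has `a_j ≍ 1∕j²`, the border). [folklore] -/
theorem sum_abs_increments_le_of_chebyshev {Λ : ℕ → Measure ℝ} [∀ K, IsProbabilityMeasure (Λ K)]
    (hΛ : ∀ K, Λ K (Set.Icc (-1 : ℝ) 1)ᶜ = 0) {C θ : ℝ} (hC : 0 < C) (hθ0 : 0 < θ) (hθ1 : θ < 1)
    (hmom : ∀ K i : ℕ, |∫ x, x ^ i ∂Λ (K + 1) - ∫ x, x ^ i ∂Λ K| ≤ C * θ ^ K)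
    {g : ℝ → ℝ} {a : ℕ → ℝ} (ha : Summable fun j => |a j|) (ha1 : Summable fun j => j * |a j|)
    (hg : ∀ x ∈ Set.Icc (-1 : ℝ) 1, HasSum (fun j => a j * (T ℝ j).eval x) (g x)) (N : ℕ) :
    ∑ K ∈ Finset.range N, |∫ x, g x ∂Λ (K + 1) - ∫ x, g x ∂Λ K| ≤
      ∑' j : ℕ, |a j| * (2 * ((j * Real.log 3 + Real.posLog C) / Real.log θ⁻¹ + 1) + 1 / (1 - θ)) := by
  have hlam_pos : 0 < Real.log θ⁻¹ := Real.log_pos ((one_lt_inv₀ hθ0).2 hθ1)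
  -- the weights `w_j = 2(x_j + 1) + 1∕(1−θ)` are affine in `j`, so `Σ |a_j| w_j < ∞`
  set w : ℕ → ℝ := fun j => 2 * ((j * Real.log 3 + Real.posLog C) / Real.log θ⁻¹ + 1) + 1 / (1 - θ) with hw
  have hw0 : ∀ j, 0 ≤ w j := fun j => by
    simp only [hw]
    have : 0 ≤ (j * Real.log 3 + Real.posLog C) / Real.log θ⁻¹ :=
      div_nonneg (add_nonneg (mul_nonneg (Nat.cast_nonneg j) (Real.log_nonneg (by norm_num))) Real.posLog_nonneg) hlam_pos.le
    have : 0 ≤ 1 / (1 - θ) := by have := sub_pos.2 hθ1; positivity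
    linarith
  have hsumw : Summable fun j : ℕ => |a j| * w j := by
    have e : ∀ j : ℕ, |a j| * w j = (2 * Real.log 3 / Real.log θ⁻¹) * (j * |a j|) +
        (2 * (Real.posLog C / Real.log θ⁻¹ + 1) + 1 / (1 - θ)) * |a j| := fun j => by
      simp only [hw]; field_simp; ring
    simp_rw [e]
    exact (ha1.mul_left _).add (ha.mul_left _)
  -- each step `K`: `|incr_K| ≤ Σ_j |a_j| min(2, 3^j Cθ^K)`; summable in `j` for each `K`
  have hstepS : ∀ K : ℕ, Summable fun j : ℕ => |a j| * min 2 (3 ^ j * (C * θ ^ K)) := fun K =>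
    Summable.of_nonneg_of_le (fun j => mul_nonneg (abs_nonneg _) (le_min (by norm_num) (by positivity)))
      (fun j => mul_le_mul_of_nonneg_left (min_le_left _ _) (abs_nonneg _)) (ha.mul_right 2)
  have hstep : ∀ K : ℕ, |∫ x, g x ∂Λ (K + 1) - ∫ x, g x ∂Λ K| ≤ ∑' j : ℕ, |a j| * min 2 (3 ^ j * (C * θ ^ K)) := fun K =>
    abs_integral_sub_le_tsum_of_chebyshev (hΛ (K + 1)) (hΛ K) (hmom K) ha hg
  calc ∑ K ∈ Finset.range N, |∫ x, g x ∂Λ (K + 1) - ∫ x, g x ∂Λ K|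
      ≤ ∑ K ∈ Finset.range N, ∑' j : ℕ, |a j| * min 2 (3 ^ j * (C * θ ^ K)) := Finset.sum_le_sum fun K _ => hstep K
    _ = ∑' j : ℕ, ∑ K ∈ Finset.range N, |a j| * min 2 (3 ^ j * (C * θ ^ K)) := (Summable.tsum_finsetSum fun K _ => hstepS K).symm
    _ = ∑' j : ℕ, |a j| * ∑ K ∈ Finset.range N, min 2 (3 ^ j * (C * θ ^ K)) := tsum_congr fun j => by rw [Finset.mul_sum]
    _ ≤ ∑' j : ℕ, |a j| * w j := by
        refine Summable.tsum_le_tsum (fun j => mul_le_mul_of_nonneg_left (sum_min_two_geometric_le hC hθ0 hθ1 j N) (abs_nonneg _))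
          ?_ hsumw
        exact Summable.of_nonneg_of_le
          (fun j => mul_nonneg (abs_nonneg _) (Finset.sum_nonneg fun K _ => le_min (by norm_num) (by positivity)))
          (fun j => mul_le_mul_of_nonneg_left (sum_min_two_geometric_le hC hθ0 hθ1 j N) (abs_nonneg _)) hsumw

/-- ★★ Summable form: under uniform moment matching at geometric closeness EVERY Chebyshev-summable observable with `Σ j|a_j| < ∞` has ABSOLUTELY
summable increments along EVERY sequence, with the explicit bound of `sum_abs_increments_le_of_chebyshev`. [folklore] -/
theorem summable_abs_increments_of_chebyshev {Λ : ℕ → Measure ℝ} [∀ K, IsProbabilityMeasure (Λ K)]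
    (hΛ : ∀ K, Λ K (Set.Icc (-1 : ℝ) 1)ᶜ = 0) {C θ : ℝ} (hC : 0 < C) (hθ0 : 0 < θ) (hθ1 : θ < 1)
    (hmom : ∀ K i : ℕ, |∫ x, x ^ i ∂Λ (K + 1) - ∫ x, x ^ i ∂Λ K| ≤ C * θ ^ K)
    {g : ℝ → ℝ} {a : ℕ → ℝ} (ha : Summable fun j => |a j|) (ha1 : Summable fun j => j * |a j|)
    (hg : ∀ x ∈ Set.Icc (-1 : ℝ) 1, HasSum (fun j => a j * (T ℝ j).eval x) (g x)) :
    Summable (fun K => |∫ x, g x ∂Λ (K + 1) - ∫ x, g x ∂Λ K|) ∧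
      ∑' K, |∫ x, g x ∂Λ (K + 1) - ∫ x, g x ∂Λ K| ≤
        ∑' j : ℕ, |a j| * (2 * ((j * Real.log 3 + Real.posLog C) / Real.log θ⁻¹ + 1) + 1 / (1 - θ)) :=
  ⟨summable_of_sum_range_le (fun _ => abs_nonneg _) (sum_abs_increments_le_of_chebyshev hΛ hC hθ0 hθ1 hmom ha ha1 hg),
    Real.tsum_le_of_sum_range_le (fun _ => abs_nonneg _) (sum_abs_increments_le_of_chebyshev hΛ hC hθ0 hθ1 hmom ha ha1 hg)⟩

end Summit.QuantumFields.YangMills.Theorems.BalabanUVNodesN19UniformMomentsChebyshevRoad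

end
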